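import Summits.QuantumFields.QCD.Theses.QuarksAsStableAction
import Literature.MathematicalPhysics.QuantumLattice.WilsonDiracAP
import Summits.QuantumFields.QCD.Theorems.QuarksAsStableActionCriticalLineDiamagnetismStubFrequencyDiamagnetismAux3
import Summits.QuantumFields.QCD.Theorems.QuarksAsStableActionWilsonQuarkStabilityStubReflectionStep
import Summits.QuantumFields.QCD.Theorems.QuarksAsStableActionWilsonQuarkStabilityStubChessboardOfReflection
import Summits.QuantumFields.QCD.Theorems.QuarksAsStableActionWilsonQuarkStabilityStubCyclicHolder
import Summits.QuantumFields.QCD.Theorems.QuarksAsStableActionWilsonQuarkStabilityStubNormDetChainBlock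
import Summits.QuantumFields.QCD.Theorems.QuarksAsStableActionWilsonQuarkStabilityStubStaticIterate

/-!
# Stub `stub_frequencyDiamagnetism` of line `Sketch` (static route for odd tori)
(crux `Summit.QuantumFields.QCD.Theses.QuarksAsStableAction.CriticalLineDiamagnetism`, item stmt-QuantumFields-9734)

**Per-frequency diamagnetism of the 2D frequency operator.**  For odd `L`, every 2D `U(3)` field
`A : ℤ/L → ℤ/L → Fin 4 → U(3)`, every `m > −1` and EVERY real frequency pair `(ω₀, ω₁)`, the determinant of the 2D
frequency operator `D[A] = N_ω ⊗ 1 − H_A` (`N_ω = (m + 4 − cos ω₀ − cos ω₁)·1 + i(sin ω₀ γ₀ + sin ω₁ γ₁)`, `H_A` the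
seam-signed `r = 1` Wilson hops of the links `A(·,·,2)`, `A(·,·,3)`) is dominated by the free one:
`‖det D[A]‖ ≤ ‖det D[1]‖`.

Proof — the sibling crux 9736's transfer-matrix pipeline run on the 2D operator (auxiliary files 1–3):
* `stub_frequencyDiamagnetismAux3`: the static slice bound along the first coordinate,
  `‖det D[B]‖^L ≤ ∏_s ‖det D[S_s B]‖` for every field `B` (`S_s B`: links along the second coordinate read on row `s`,
  trivial links along the first), from Lüscher's transfer form of `det D` (time = first coordinate, after the spin
  rotation `γ₂ ↔ γ₀`), the Fock functor, the cyclic Hölder / chessboard inequality (`stub_cyclicHolder` with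
  `stub_reflectionStep`, `stub_chessboardOfReflection`; this is where `Odd L` enters) and the chain-block lemma
  `stub_normDetChainBlock` — discharged here exactly as in `diamagnetic_odd`;
* `stub_frequencyDiamagnetismAux1`: the reflection covariance `det D[B] = det D[Bᵀ]`, `Bᵀ a b μ = B b a ((2 3) μ)`,
  which turns the bound along the second coordinate into the bound along the first;
* two static slice operations make every link trivial (`D` only reads the links along the two coordinates), and the
  `L`-th roots are taken level by level (`staticIterate_root`).
-/

noncomputable section

open scoped BigOperators Matrix ComplexConjugate
open Finset
open Literature.MathematicalPhysics.QuantumLattice Literature.MathematicalPhysics.QuantumFieldTheory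
  Literature.Probability.LatticeModels

namespace Summit.QuantumFields.QCD.Cruxes.CriticalLineDiamagnetism.ChessboardCellGain

open Summit.QuantumFields.QCD.Cruxes.WilsonQuarkStability.FreeTangentLandauChessboard

/-- **Stub `stub_frequencyDiamagnetism` of line `Sketch`** (per-frequency diamagnetic inequality on odd tori): for
every 2D `U(3)` field, every `m > −1` and every real frequency pair, the 2D frequency determinant is dominated by the
free one, `‖det fD A‖ ≤ ‖det fD 1‖` — two static slice bounds (`stub_frequencyDiamagnetismAux3`, along the first
coordinate, and along the second one through the reflection covariance `stub_frequencyDiamagnetismAux1`) with the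
sibling crux's cyclic Hölder inequality and chain-block lemma, then `L`-th roots. -/
theorem stub_frequencyDiamagnetism : ∀ (L : ℕ) [NeZero L], Odd L → ∀ (A : ZMod L → ZMod L → Fin 4 → Matrix.unitaryGroup (Fin 3) ℂ) (m : ℝ), -1 < m → ∀ ω₀ ω₁ : ℝ, let fD := fun (A : ZMod L → ZMod L → Fin 4 → Matrix.unitaryGroup (Fin 3) ℂ) (m ω₀ ω₁ : ℝ) => Matrix.of fun (p q : (ZMod L × ZMod L) × Fin 3 × Fin 4) => (if p.1 = q.1 ∧ p.2.1 = q.2.1 then (((m + 4 - Real.cos ω₀ - Real.cos ω₁ : ℝ) : ℂ) * (1 : Matrix (Fin 4) (Fin 4) ℂ) p.2.2 q.2.2 + Complex.I * (((Real.sin ω₀ : ℝ) : ℂ) * euclideanGamma 0 p.2.2 q.2.2 + ((Real.sin ω₁ : ℝ) : ℂ) * euclideanGamma 1 p.2.2 q.2.2)) else 0) - (1 / 2 : ℂ) * ((if q.1 = (p.1.1 + 1, p.1.2) then ((1 : Matrix (Fin 4) (Fin 4) ℂ) - euclideanGamma 2) p.2.2 q.2.2 * ((if p.1.1 = -1 then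 (-1 : ℂ) else 1) * (A p.1.1 p.1.2 2 : Matrix (Fin 3) (Fin 3) ℂ) p.2.1 q.2.1) else 0) + (if p.1 = (q.1.1 + 1, q.1.2) then ((1 : Matrix (Fin 4) (Fin 4) ℂ) + euclideanGamma 2) p.2.2 q.2.2 * ((if q.1.1 = -1 then (-1 : ℂ) else 1) * (star (A q.1.1 q.1.2 2 : Matrix (Fin 3) (Fin 3) ℂ)) p.2.1 q.2.1) else 0) + (if q.1 = (p.1.1, p.1.2 + 1) then ((1 : Matrix (Fin 4) (Fin 4) ℂ) - euclideanGamma 3) p.2.2 q.2.2 * ((if p.1.2 = -1 then (-1 : ℂ) else 1) * (A p.1.1 p.1.2 3 : Matrix (Fin 3) (Fin 3) ℂ) p.2.1 q.2.1) else 0) + (if p.1 = (q.1.1, q.1.2 + 1) then ((1 : Matrix (Fin 4) (Fin 4) ℂ) + euclideanGamma 3) p.2.2 q.2.2 * ((if q.1.2 = -1 then (-1 : ℂ) else 1) * (star (A q.1.1 q.1.2 3 : Matrix (Fin 3) (Fin 3) ℂ)) p.2.1 q.2.1) else 0)); ‖(fD A m ω₀ ω₁).det‖ ≤ ‖(fD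 (fun _ _ _ => 1) m ω₀ ω₁).det‖ := by
  intro L _ hL A m hm ω₀ ω₁ fD
  show ‖(FrequencyDiamagnetism.freqOp euclideanGamma A m ω₀ ω₁).det‖ ≤
    ‖(FrequencyDiamagnetism.freqOp (L := L) euclideanGamma (fun _ _ _ => 1) m ω₀ ω₁).det‖
  -- the static slice bound along the first coordinate for EVERY 2D field: aux theorem 3 with the sibling crux's
  -- cyclic Hölder / chessboard inequality (odd `L`) and chain-block lemma, discharged as in `diamagnetic_odd`
  have hS : ∀ B : ZMod L → ZMod L → Fin 4 → Matrix.unitaryGroup (Fin 3) ℂ,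
      ‖(FrequencyDiamagnetism.freqOp euclideanGamma B m ω₀ ω₁).det‖ ^ L ≤
        ∏ s : ZMod L, ‖(FrequencyDiamagnetism.freqOp euclideanGamma
          (fun _ x μ => if μ = 3 then B s x 3 else 1) m ω₀ ω₁).det‖ :=
    fun B => stub_frequencyDiamagnetismAux3 L
      (fun T u hT hu => stub_cyclicHolder
        (fun n T hT U hU e he ι hι c v => stub_reflectionStep n T hT U hU e he ι hι c v)
        (fun n F hF ν hν e ι hιe hrot hrefl hhom c v =>
          stub_chessboardOfReflection n F hF ν hν e ι hιe hrot hrefl hhom c v)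
        hL T u hT hu)
      (fun A Pp Pm W hP hPQ hQP hPph hPmh hW hWp hWm =>
        stub_normDetChainBlock A Pp Pm W hP hPQ hQP hPph hPmh hW hWp hWm)
      B m hm ω₀ ω₁
  -- the reflection covariance (aux theorem 1)
  have hT : ∀ B : ZMod L → ZMod L → Fin 4 → Matrix.unitaryGroup (Fin 3) ℂ,
      (FrequencyDiamagnetism.freqOp euclideanGamma B m ω₀ ω₁).det =
        (FrequencyDiamagnetism.freqOp euclideanGamma (fun a b μ => B b a (Equiv.swap (2 : Fin 4) 3 μ)) m ω₀ ω₁).det :=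
    fun B => stub_frequencyDiamagnetismAux1 L B m ω₀ ω₁
  -- the frequency operator only reads the links along the two coordinates
  have key : ∀ B : ZMod L → ZMod L → Fin 4 → Matrix.unitaryGroup (Fin 3) ℂ,
      (∀ t x, B t x 2 = 1) → (∀ t x, B t x 3 = 1) →
      ‖(FrequencyDiamagnetism.freqOp euclideanGamma B m ω₀ ω₁).det‖ =
        ‖(FrequencyDiamagnetism.freqOp (L := L) euclideanGamma (fun _ _ _ => 1) m ω₀ ω₁).det‖ := fun B h2 h3 =>
    congrArg (fun M : Matrix ((ZMod L × ZMod L) × Fin 3 × Fin 4) ((ZMod L × ZMod L) × Fin 3 × Fin 4) ℂ => ‖M.det‖)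
      (FrequencyDiamagnetism.freqOp_congr_links (fun _ _ _ => 1) B m ω₀ ω₁ euclideanGamma
        (fun t x => h2 t x) (fun t x => h3 t x))
  -- static along the first coordinate, reflect, static again: every link becomes trivial; take the roots
  refine staticIterate_root (norm_nonneg _) (hS A) (fun _ => norm_nonneg _) fun s => ?_
  rw [hT]
  refine staticIterate_root (norm_nonneg _) (hS _) (fun _ => norm_nonneg _) fun s' =>
    le_of_eq (key _ (fun t x => ?_) (fun t x => ?_))
  · simp
  · simp

end Summit.QuantumFields.QCD.Cruxes.CriticalLineDiamagnetism.ChessboardCellGain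

end
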